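import Summits.CriticalPhenomena.SAWScalingLimit.Theorems.SAWReversalUpgradeFaithfulOfNoReturnExit
import Summits.CriticalPhenomena.SAWScalingLimit.Theorems.SAWReversalUpgradeFaithfulOfNoReturnPathGlue
import HarnessLib

/-!
# Route `SAWReversalUpgrade`, support `FaithfulOfNoReturn` (stmt-CriticalPhenomena-18008):
# the model curve, I — access piece, middle piece, and the time changes

Helper file (7 of several) for the proof of
`Summit.CriticalPhenomena.SAWScalingLimit.Theses.SAWReversalUpgrade.FaithfulOfNoReturn`.

The faithfulness estimate compares a standard attachment `c` (an injective curve whose TRACE is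
prescribed) with the polyline `P` through a *model curve*: the concatenation (`Path.trans`) of
* the access piece `t ↦ Φ ((t · sAcc) · pAcc)` from `a` to the access crossing (`exists_accessPath`);
* the middle piece `t ↦ attZ (uMid + t (vMid - uMid))`, the pushed polyline between the two cut
  times (`exists_midPath`; flat because the polyline is flat and the patched squeeze is injective);
* the exit piece (next file).
Each piece comes with: flatness, its range, the "junction property" (it meets the pushed middle arc
`midSet` only at the junction value), and pointwise closeness data. We also build the affine time
changes `t ↦ t·u`, `t ↦ u + t(v-u)`, `t ↦ v + t(1-v)` of `unitInterval` as monotone paths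
(`exists_timeChanges`).
-/

noncomputable section

open Set Filter Metric Complex Function
open scoped Topology unitInterval
open UpperHalfPlane (upperHalfPlaneSet)
open Literature.Probability.RandomPlanarGeometry

namespace Summit.CriticalPhenomena.SAWScalingLimit.Theorems

namespace FaithfulAttach

open AttachReversal

variable {D : DobrushinDomain} {φ : ConformalEquiv upperHalfPlaneSet D.carrier} {e : ℝ} {R : ℝ → ℂ}
  (hφ : D.IsChordalUniformizing φ) (he0 : 0 < e) (he1 : e ≤ 1 / 2)
  (hRc : Continuous R) (hRmem : ∀ u, R u ∈ closure D.carrier) (hR0 : R 0 ∈ D.carrier)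
  (hij : lastA (D.pt 0) R ≤ firstB (D.pt 1) R)

/-! ### The access piece -/

include hφ he0 he1 hRc hRmem hR0 hij in
/-- **The access piece of the model curve.** A path from `a` to the access crossing
`Φ (sAcc · pAcc)` which is flat, has range `Φ ([0, sAcc] · pAcc)`, meets `midSet` only at its endpoint,
and stays `r₀/4`-close to `a`. -/
theorem exists_accessPath {r₀ : ℝ}
    (hacc : ∀ z : ℂ, 0 ≤ z.im → ‖z‖ ≤ ‖hinv φ.boundaryExtension (R 0)‖ →
      dist (φ.boundaryExtension z) (D.pt 0) < r₀ / 4) :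
    ∃ γ : Path (D.pt 0) (φ.boundaryExtension ((sAcc (D.pt 0) (D.pt 1) φ.boundaryExtension e R : ℂ) *
      pAcc (D.pt 0) φ.boundaryExtension e R)),
      (Curve.ofPath γ).IsFlat ∧
      Set.range γ = (fun t : ℝ => φ.boundaryExtension ((t : ℂ) * pAcc (D.pt 0) φ.boundaryExtension e R)) ''
        Icc 0 (sAcc (D.pt 0) (D.pt 1) φ.boundaryExtension e R) ∧
      (∀ t, γ t ∈ midSet (D.pt 0) (D.pt 1) φ.boundaryExtension e R →
        γ t = φ.boundaryExtension ((sAcc (D.pt 0) (D.pt 1) φ.boundaryExtension e R : ℂ) *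
          pAcc (D.pt 0) φ.boundaryExtension e R)) ∧
      (∀ t, dist (γ t) (D.pt 0) < r₀ / 4) := by
  obtain ⟨hs01, -, hα0, hαc, hαinj, hαM, hαmem, hαnorm⟩ := sAcc_facts hφ he0 he1 hRc hRmem hR0 hij
  set s := sAcc (D.pt 0) (D.pt 1) φ.boundaryExtension e R with hs
  set p := pAcc (D.pt 0) φ.boundaryExtension e R with hp
  -- the path `t ↦ Φ ((t · s) · p)`
  have hts : ∀ t : I, (t : ℝ) * s ∈ Icc 0 s := fun t =>
    ⟨mul_nonneg t.2.1 hs01.1, mul_le_of_le_one_left hs01.1 t.2.2⟩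
  have hcont : Continuous fun t : I => φ.boundaryExtension ((((t : ℝ) * s : ℝ) : ℂ) * p) :=
    hαc.comp_continuous (continuous_subtype_val.mul continuous_const) fun t => (hts t).1
  let γ : Path (D.pt 0) (φ.boundaryExtension ((s : ℂ) * p)) :=
    { toFun := fun t : I => φ.boundaryExtension ((((t : ℝ) * s : ℝ) : ℂ) * p)
      continuous_toFun := hcont
      source' := by
        show φ.boundaryExtension (((((0 : I) : ℝ) * s : ℝ) : ℂ) * p) = D.pt 0
        rw [show (((0 : I) : ℝ) * s : ℝ) = 0 by simp]
        exact hα0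
      target' := by
        show φ.boundaryExtension (((((1 : I) : ℝ) * s : ℝ) : ℂ) * p) = φ.boundaryExtension ((s : ℂ) * p)
        rw [show (((1 : I) : ℝ) * s : ℝ) = s by simp] }
  have hγ : ∀ t : I, γ t = φ.boundaryExtension ((((t : ℝ) * s : ℝ) : ℂ) * p) := fun t => rfl
  refine ⟨γ, ?_, ?_, ?_, ?_⟩
  · -- flatness: constant if `s = 0`, injective otherwise
    rcases hs01.1.eq_or_lt with hs0 | hs0
    · refine isFlat_ofPath_of_const fun t => ?_
      rw [hγ, ← hs0, mul_zero]
      exact hα0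
    · refine isFlat_ofPath_of_injective fun t t' htt' => ?_
      rw [hγ, hγ] at htt'
      have h := hαinj (hts t) (hts t') htt'
      exact Subtype.ext (mul_right_cancel₀ hs0.ne' h)
  · -- range
    ext x
    constructor
    · rintro ⟨t, rfl⟩
      exact ⟨(t : ℝ) * s, hts t, (hγ t).symm⟩
    · rintro ⟨y, hy, rfl⟩
      rcases hs01.1.eq_or_lt with hs0 | hs0
      · refine ⟨0, ?_⟩
        rw [hγ]
        have : y = 0 := le_antisymm (hs0 ▸ hy.2) hy.1
        rw [this]
        simp
      · refine ⟨⟨y / s, div_nonneg hy.1 hs01.1, (div_le_one hs0).2 hy.2⟩, ?_⟩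
        rw [hγ]
        simp only [div_mul_cancel₀ y hs0.ne']
  · -- junction property
    intro t htM
    rw [hγ] at htM ⊢
    rcases (hts t).2.eq_or_lt with heq | hlt
    · rw [heq]
    · exact absurd htM (hαM _ ⟨(hts t).1, hlt⟩)
  · -- closeness to `a`
    intro t
    rw [hγ]
    have h01 : (t : ℝ) * s ∈ Icc (0:ℝ) 1 := ⟨(hts t).1, (hts t).2.trans hs01.2⟩
    exact hacc _ (hαmem _ h01.1).2 (hαnorm _ h01)

/-! ### The middle piece -/

/-- The extended polyline `projLine P` is flat on `[0, 1]` if the curve `⟨P⟩` is flat. -/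
theorem projLine_flat {P : C(I, ℂ)} (hflat : (⟨P⟩ : Curve ℂ).IsFlat) {x y w : ℝ}
    (hx : x ∈ Icc (0:ℝ) 1) (hy : y ∈ Icc (0:ℝ) 1) (hw : w ∈ Icc (0:ℝ) 1)
    (hxy : x ≤ y) (hyw : y ≤ w) (h : projLine P x = projLine P w) : projLine P y = projLine P x := by
  simp only [projLine, projIcc_of_mem _ hx, projIcc_of_mem _ hy, projIcc_of_mem _ hw] at h ⊢
  exact hflat ⟨x, hx⟩ ⟨y, hy⟩ ⟨w, hw⟩ hxy hyw h

/-- On `[0, 1]` the extended polyline is the polyline. -/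
theorem projLine_apply_coe (P : C(I, ℂ)) (t : I) : projLine P t = P t := by
  simp only [projLine, projIcc_val]

include hφ he0 he1 hRc hRmem in
/-- **The middle piece of the model curve.** For `u ≤ v` in `[0, 1]` and a flat polyline `P`, the
pushed polyline `t ↦ attZ (u + t (v - u))` is a flat path from `attZ u` to `attZ v` with range
`attZ '' [u, v]`. -/
theorem exists_midPath {P : C(I, ℂ)} (hRP : R = projLine P) (hflat : (⟨P⟩ : Curve ℂ).IsFlat)
    {u v : ℝ} (hu : u ∈ Icc (0:ℝ) 1) (hv : v ∈ Icc (0:ℝ) 1) (huv : u ≤ v) :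
    ∃ γ : Path (attZ (D.pt 1) φ.boundaryExtension e R u) (attZ (D.pt 1) φ.boundaryExtension e R v),
      (Curve.ofPath γ).IsFlat ∧
      Set.range γ = attZ (D.pt 1) φ.boundaryExtension e R '' Icc u v ∧
      ∀ t : I, γ t = attZ (D.pt 1) φ.boundaryExtension e R (u + (t : ℝ) * (v - u)) := by
  have hmem : ∀ t : I, u + (t : ℝ) * (v - u) ∈ Icc u v := fun t =>
    ⟨le_add_of_nonneg_right (mul_nonneg t.2.1 (sub_nonneg.2 huv)),
      by nlinarith [t.2.2, sub_nonneg.2 huv]⟩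
  have hmem01 : ∀ t : I, u + (t : ℝ) * (v - u) ∈ Icc (0:ℝ) 1 := fun t =>
    ⟨hu.1.trans (hmem t).1, (hmem t).2.trans hv.2⟩
  have hZc : Continuous (attZ (D.pt 1) φ.boundaryExtension e R) :=
    (continuousOn_transport' hφ he0 he1).comp_continuous hRc hRmem
  let γ : Path (attZ (D.pt 1) φ.boundaryExtension e R u) (attZ (D.pt 1) φ.boundaryExtension e R v) :=
    { toFun := fun t : I => attZ (D.pt 1) φ.boundaryExtension e R (u + (t : ℝ) * (v - u))
      continuous_toFun := hZc.comp (continuous_const.add (continuous_subtype_val.mul continuous_const))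
      source' := by
        show attZ (D.pt 1) φ.boundaryExtension e R (u + ((0 : I) : ℝ) * (v - u)) = _
        simp
      target' := by
        show attZ (D.pt 1) φ.boundaryExtension e R (u + ((1 : I) : ℝ) * (v - u)) = _
        simp }
  have hγ : ∀ t : I, γ t = attZ (D.pt 1) φ.boundaryExtension e R (u + (t : ℝ) * (v - u)) := fun t => rfl
  refine ⟨γ, ?_, ?_, hγ⟩
  · intro s w t hsw hwt hst
    change γ w = γ s
    change γ s = γ t at hst
    rw [hγ, hγ] at hst ⊢
    rw [attZ_eq_attZ_iff hφ he0 he1 hRmem] at hst ⊢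
    have hsw' : (s : ℝ) ≤ w := hsw
    have hwt' : (w : ℝ) ≤ t := hwt
    have h1 : u + (s : ℝ) * (v - u) ≤ u + (w : ℝ) * (v - u) := by nlinarith [sub_nonneg.2 huv]
    have h2 : u + (w : ℝ) * (v - u) ≤ u + (t : ℝ) * (v - u) := by nlinarith [sub_nonneg.2 huv]
    rw [hRP] at hst ⊢
    exact projLine_flat hflat (hmem01 s) (hmem01 w) (hmem01 t) h1 h2 hst
  · ext x
    constructor
    · rintro ⟨t, rfl⟩
      exact ⟨_, hmem t, (hγ t).symm⟩
    · rintro ⟨y, hy, rfl⟩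
      rcases huv.eq_or_lt with heq | hlt
      · refine ⟨0, ?_⟩
        rw [hγ]
        have : y = u := le_antisymm (heq ▸ hy.2) hy.1
        simp [this]
      · have hvu : 0 < v - u := sub_pos.2 hlt
        refine ⟨⟨(y - u) / (v - u), div_nonneg (sub_nonneg.2 hy.1) hvu.le,
          (div_le_one hvu).2 (sub_le_sub_right hy.2 u)⟩, ?_⟩
        rw [hγ]
        simp only [div_mul_cancel₀ _ hvu.ne', add_sub_cancel]

/-! ### The affine time changes -/

/-- **The affine time changes** `t ↦ t·u`, `t ↦ u + t(v-u)`, `t ↦ v + t(1-v)` of `unitInterval`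
(`0 ≤ u ≤ v ≤ 1`) as monotone paths `0 ⟶ u ⟶ v ⟶ 1`. -/
theorem exists_timeChanges {u v : ℝ} (hu : u ∈ Icc (0:ℝ) 1) (hv : v ∈ Icc (0:ℝ) 1) (huv : u ≤ v) :
    ∃ (θ₁ : Path (0 : I) ⟨u, hu⟩) (θ₂ : Path (⟨u, hu⟩ : I) ⟨v, hv⟩) (θ₃ : Path (⟨v, hv⟩ : I) 1),
      Monotone θ₁ ∧ Monotone θ₂ ∧ Monotone θ₃ ∧
      (∀ t : I, (θ₁ t : ℝ) = (t : ℝ) * u) ∧ (∀ t : I, (θ₂ t : ℝ) = u + (t : ℝ) * (v - u)) ∧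
      (∀ t : I, (θ₃ t : ℝ) = v + (t : ℝ) * (1 - v)) := by
  have h1mem : ∀ t : I, (t : ℝ) * u ∈ Icc (0:ℝ) 1 := fun t =>
    ⟨mul_nonneg t.2.1 hu.1, (mul_le_of_le_one_left hu.1 t.2.2).trans hu.2⟩
  have h2mem : ∀ t : I, u + (t : ℝ) * (v - u) ∈ Icc (0:ℝ) 1 := fun t =>
    ⟨hu.1.trans (le_add_of_nonneg_right (mul_nonneg t.2.1 (sub_nonneg.2 huv))),
      (by nlinarith [t.2.2, sub_nonneg.2 huv] : u + (t : ℝ) * (v - u) ≤ v).trans hv.2⟩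
  have h3mem : ∀ t : I, v + (t : ℝ) * (1 - v) ∈ Icc (0:ℝ) 1 := fun t =>
    ⟨hv.1.trans (le_add_of_nonneg_right (mul_nonneg t.2.1 (sub_nonneg.2 hv.2))),
      by nlinarith [t.2.2, sub_nonneg.2 hv.2]⟩
  let θ₁ : Path (0 : I) ⟨u, hu⟩ :=
    { toFun := fun t => ⟨(t : ℝ) * u, h1mem t⟩
      continuous_toFun := (continuous_subtype_val.mul continuous_const).subtype_mk _
      source' := Subtype.ext (by simp)
      target' := Subtype.ext (by simp) }
  let θ₂ : Path (⟨u, hu⟩ : I) ⟨v, hv⟩ :=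
    { toFun := fun t => ⟨u + (t : ℝ) * (v - u), h2mem t⟩
      continuous_toFun := (continuous_const.add (continuous_subtype_val.mul continuous_const)).subtype_mk _
      source' := Subtype.ext (by simp)
      target' := Subtype.ext (by simp) }
  let θ₃ : Path (⟨v, hv⟩ : I) 1 :=
    { toFun := fun t => ⟨v + (t : ℝ) * (1 - v), h3mem t⟩
      continuous_toFun := (continuous_const.add (continuous_subtype_val.mul continuous_const)).subtype_mk _
      source' := Subtype.ext (by simp)
      target' := Subtype.ext (by simp [Set.Icc.coe_one]) }
  refine ⟨θ₁, θ₂, θ₃, ?_, ?_, ?_, fun t => rfl, fun t => rfl, fun t => rfl⟩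
  · intro s t hst
    exact Subtype.mk_le_mk.2 (mul_le_mul_of_nonneg_right hst hu.1)
  · intro s t hst
    have : (s : ℝ) ≤ t := hst
    exact Subtype.mk_le_mk.2 (by nlinarith [sub_nonneg.2 huv])
  · intro s t hst
    have : (s : ℝ) ≤ t := hst
    exact Subtype.mk_le_mk.2 (by nlinarith [sub_nonneg.2 hv.2])

end FaithfulAttach

end Summit.CriticalPhenomena.SAWScalingLimit.Theorems
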